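import Literature.Claims.NS.Lindgren2012
import Literature.Analysis.FluidPDE.ConstantinFeffermanEnstrophySlab
import Literature.Analysis.FluidPDE.LerayHopfMild
import Literature.Analysis.FluidPDE.AxisymNoSwirlTaoBounds
import Literature.Analysis.FluidPDE.EnergyToolkit
import HarnessLib

/-!
# Solo salvage for claim C32 `Lindgren2012`, part 4a (cell `ns-claims`, D-0090): tools for the
# pointwise-in-time enstrophy identity on `ℝ³` in the Beale–Kato–Majda class

Claim skeleton: `Literature/Claims/NS/Lindgren2012.lean` (J. Lindgren, arXiv:1207.1090 v3). This file
(seat `ns-claims-salvage-p3` g3) holds the measure-theoretic tools of the kernel discharge of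
`Step3_EnstrophyEvolution` ((14)–(25), print p. 2–3; `SoloSalvageLindgren2012Enstrophy.lean`), none of
them specific to the paper:

* `inner_cross_cyclic` — cyclicity of the scalar triple product for the tree's `cross`;
* `abs_integral_le_of_norm_le_mul` — Cauchy–Schwarz for a bounded bilinear pairing of two continuous
  `L²` fields; `lintegral_enorm_sub_sq_lt_top`, `integral_norm_sq_le_toReal` — `L²` plumbing;
* `tendsto_integral_norm_sub_sq` — **`L²`-continuity in time** of a jointly smooth field with
  `L^∞_t L²_x` bounds on itself and on its time derivative (`∫|w(s) − w(s₀)|² → 0` as `s → s₀` within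
  `[0,T]`), from the tree's `ℓ²` balance `IsSmoothSpaceTimeOn.l2_balance` applied to `w − w(s₀)`;
* `integral_inner_laplacian_symm` — **Green's second identity `∫⟪η, Δζ⟫ = ∫⟪ζ, Δη⟫` in the `H²`
  class** (no decay, no compact support), from the tree's `H¹` form of the Laplacian pairing
  `HasWeakGradient.integral_inner_laplacian_of_memLp`;
* `memLp_curl_partials` — `ω = curl v`, `∂ᵢω`, `∂ᵢ∂ᵢω ∈ L²` when `Dv, D²v, D³v ∈ L²`.

Solo lane (`Theorems/SoloSalvage<Slug>….lean`, no item).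

WHAT THIS IS NOT: not a claim about NS regularity or blow-up; not a claim about any author beyond the
typed locator.
-/

noncomputable section

set_option linter.dupNamespace false
-- nested operator types (second derivatives of slices)
set_option maxSynthPendingDepth 3

open MeasureTheory Set Filter
open _root_.Topology
open scoped ENNReal NNReal ContDiff RealInnerProductSpace Laplacian

namespace Summit.NavierStokesRegularity.NavierStokesRegularity.Theorems.Lindgren2012Salvage

open Literature.Analysis.FluidPDE Literature.Claims.NS.Ruzmaikina2008 Literature.Claims.NS.Lindgren2012

/-! ## §0 Pointwise and measure-theoretic helpers -/

/-- Cyclic invariance of the scalar triple product for the tree's `cross` on `ℝ³`: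
`⟪a, b × c⟫ = ⟪c, a × b⟫`. [folklore] -/
theorem inner_cross_cyclic (a b c : EuclideanSpace ℝ (Fin 3)) :
    ⟪a, cross b c⟫ = ⟪c, cross a b⟫ := by
  have h : ⟪a, cross b c⟫ - ⟪c, cross a b⟫ = 0 := by
    simp [cross, cross_apply, PiLp.inner_apply, Fin.sum_univ_three]
    ring
  exact sub_eq_zero.1 h

/-- The curl of a difference of differentiable fields. [folklore] -/
theorem curl_fun_sub {a b : EuclideanSpace ℝ (Fin 3) → EuclideanSpace ℝ (Fin 3)}
    {x : EuclideanSpace ℝ (Fin 3)} (ha : DifferentiableAt ℝ a x) (hb : DifferentiableAt ℝ b x) :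
    curl (fun y => a y - b y) x = curl a x - curl b x := by
  rw [curl_eq_curlCLM, curl_eq_curlCLM, curl_eq_curlCLM,
    show (fun y => a y - b y) = a - b from rfl, fderiv_sub ha hb, map_sub]

/-- A continuous field with `∫⁻ ‖f‖ₑ² < ∞` is in `L²`. [folklore] -/
theorem memLp_two_of_continuous {F : Type*} [NormedAddCommGroup F]
    {f : EuclideanSpace ℝ (Fin 3) → F} (hf : Continuous f) (h : ∫⁻ x, ‖f x‖ₑ ^ 2 < ⊤) :
    MemLp f 2 volume :=
  ⟨hf.aestronglyMeasurable, eLpNorm_two_lt_top_of_lintegral_enorm_sq_lt_top h⟩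

/-- **Cauchy–Schwarz for a bounded bilinear pairing of two `L²` fields**: if
`|F x| ≤ M ‖f x‖ ‖g x‖` pointwise with `F` continuous and `f, g` continuous square-integrable fields,
then `F` is integrable and `|∫ F| ≤ M (∫‖f‖²)^{1/2} (∫‖g‖²)^{1/2}`. [folklore] -/
theorem abs_integral_le_of_norm_le_mul {F : EuclideanSpace ℝ (Fin 3) → ℝ}
    {f g : EuclideanSpace ℝ (Fin 3) → EuclideanSpace ℝ (Fin 3)} (hF : Continuous F)
    (hf : Continuous f) (hg : Continuous g) (hf2 : ∫⁻ x, ‖f x‖ₑ ^ 2 < ⊤)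
    (hg2 : ∫⁻ x, ‖g x‖ₑ ^ 2 < ⊤) {M : ℝ} (hM : 0 ≤ M) (hle : ∀ x, |F x| ≤ M * (‖f x‖ * ‖g x‖)) :
    Integrable F ∧
      |∫ x, F x| ≤ M * (Real.sqrt (∫ x, ‖f x‖ ^ 2) * Real.sqrt (∫ x, ‖g x‖ ^ 2)) := by
  have hf' : MemLp f 2 volume := memLp_two_of_continuous hf hf2
  have hg' : MemLp g 2 volume := memLp_two_of_continuous hg hg2
  have i2f : Integrable fun x => ‖f x‖ ^ 2 := integrable_sq_norm_of_lintegral_lt_top hf hf2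
  have i2g : Integrable fun x => ‖g x‖ ^ 2 := integrable_sq_norm_of_lintegral_lt_top hg hg2
  have iprod : Integrable fun x => ‖f x‖ * ‖g x‖ := by
    refine ((i2f.add i2g).div_const 2).mono' (hf.norm.mul hg.norm).aestronglyMeasurable
      (Eventually.of_forall fun x => ?_)
    rw [Real.norm_eq_abs, abs_of_nonneg (by positivity)]
    simp only [Pi.add_apply]
    nlinarith [sq_nonneg (‖f x‖ - ‖g x‖)]
  have iF : Integrable F := by
    refine (iprod.const_mul M).mono' hF.aestronglyMeasurable (Eventually.of_forall fun x => ?_)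
    rw [Real.norm_eq_abs]
    exact hle x
  refine ⟨iF, ?_⟩
  calc |∫ x, F x| ≤ ∫ x, |F x| := abs_integral_le_integral_abs
    _ ≤ ∫ x, M * (‖f x‖ * ‖g x‖) := integral_mono iF.abs (iprod.const_mul M) hle
    _ = M * ∫ x, ‖f x‖ * ‖g x‖ := integral_const_mul _ _
    _ ≤ M * (Real.sqrt (∫ x, ‖f x‖ ^ 2) * Real.sqrt (∫ x, ‖g x‖ ^ 2)) :=
        mul_le_mul_of_nonneg_left (integral_norm_mul_norm_le_sqrt_mul_sqrt hf' hg') hM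


/-- **Cauchy–Schwarz for `∫ ⟪a, M g⟫` with a bounded continuous operator field `M`**:
`|∫⟪a, M g⟫| ≤ B ‖a‖₂ ‖g‖₂` when `‖M(x)‖ ≤ B` (continuous `L²` fields `a, g`). [folklore] -/
theorem abs_integral_inner_clm_le {a g : EuclideanSpace ℝ (Fin 3) → EuclideanSpace ℝ (Fin 3)}
    {M : EuclideanSpace ℝ (Fin 3) → EuclideanSpace ℝ (Fin 3) →L[ℝ] EuclideanSpace ℝ (Fin 3)}
    (ha : Continuous a) (hg : Continuous g) (hM : Continuous M) (ha2 : ∫⁻ x, ‖a x‖ₑ ^ 2 < ⊤)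
    (hg2 : ∫⁻ x, ‖g x‖ₑ ^ 2 < ⊤) {B : ℝ} (hB0 : 0 ≤ B) (hB : ∀ x, ‖M x‖ ≤ B) :
    Integrable (fun x => ⟪a x, M x (g x)⟫) ∧
      |∫ x, ⟪a x, M x (g x)⟫| ≤ B * (Real.sqrt (∫ x, ‖a x‖ ^ 2) * Real.sqrt (∫ x, ‖g x‖ ^ 2)) := by
  refine abs_integral_le_of_norm_le_mul (ha.inner (hM.clm_apply hg)) ha hg ha2 hg2 hB0 fun x => ?_
  calc |⟪a x, M x (g x)⟫| ≤ ‖a x‖ * ‖M x (g x)‖ := abs_real_inner_le_norm _ _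
    _ ≤ ‖a x‖ * (B * ‖g x‖) := by
        gcongr
        exact (ContinuousLinearMap.le_opNorm _ _).trans (mul_le_mul_of_nonneg_right (hB x) (norm_nonneg _))
    _ = B * (‖a x‖ * ‖g x‖) := by ring

/-- `∫⁻ ‖a − b‖ₑ² < ∞` for continuous square-integrable fields. [folklore] -/
theorem lintegral_enorm_sub_sq_lt_top {F : Type*} [NormedAddCommGroup F]
    {a b : EuclideanSpace ℝ (Fin 3) → F}
    (ha : Continuous a) (hb : Continuous b) (ha2 : ∫⁻ x, ‖a x‖ₑ ^ 2 < ⊤)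
    (hb2 : ∫⁻ x, ‖b x‖ₑ ^ 2 < ⊤) : ∫⁻ x, ‖a x - b x‖ₑ ^ 2 < ⊤ := by
  refine lt_of_le_of_lt (lintegral_enorm_sq_le_of_norm_le_three (f := fun x => a x - b x)
    (g₃ := fun _ => (0 : EuclideanSpace ℝ (Fin 3))) ha hb continuous_const zero_le_one zero_le_one
    le_rfl fun x => ?_) ?_
  · rw [one_mul, one_mul, zero_mul, add_zero]; exact norm_sub_le _ _
  · refine ENNReal.mul_lt_top (by norm_num) ?_
    refine ENNReal.add_lt_top.2 ⟨ENNReal.add_lt_top.2 ⟨?_, ?_⟩, ?_⟩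
    · exact ENNReal.mul_lt_top ENNReal.ofReal_lt_top ha2
    · exact ENNReal.mul_lt_top ENNReal.ofReal_lt_top hb2
    · simp

/-- The real `L²` mass of a continuous field below its `ℝ≥0∞` bound. [folklore] -/
theorem integral_norm_sq_le_toReal {f : EuclideanSpace ℝ (Fin 3) → EuclideanSpace ℝ (Fin 3)}
    (hf : Continuous f) {V : ℝ≥0∞} (hV : V < ⊤) (h : ∫⁻ x, ‖f x‖ₑ ^ 2 ≤ V) :
    ∫ x, ‖f x‖ ^ 2 ≤ V.toReal := by
  have hi : Integrable fun x => ‖f x‖ ^ 2 := integrable_sq_norm_of_lintegral_lt_top hf (h.trans_lt hV)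
  have h1 : ENNReal.ofReal (∫ x, ‖f x‖ ^ 2) ≤ V := by
    rw [ofReal_integral_eq_lintegral_ofReal hi (Eventually.of_forall fun x => sq_nonneg _)]
    refine le_trans (le_of_eq (lintegral_congr fun x => ?_)) h
    rw [← ofReal_norm, ENNReal.ofReal_pow (norm_nonneg _)]
  exact (ENNReal.ofReal_le_iff_le_toReal hV.ne).1 h1

/-! ## §1 `L²` continuity in time from the `ℓ²` balance -/

/-- **`L²`-continuity in time of a jointly smooth field with `L^∞_t L²_x` bounds on itself and on
its time derivative**: `∫ ‖w(s) − w(s₀)‖² → 0` as `s → s₀` within `[0,T]` (the tree's `ℓ²` balance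
`IsSmoothSpaceTimeOn.l2_balance` applied to the difference field `w − w(s₀)`, whose balance is
continuous and vanishes at `s₀`). [folklore] -/
theorem tendsto_integral_norm_sub_sq {T : ℝ} (hT : 0 < T)
    {w : ℝ → EuclideanSpace ℝ (Fin 3) → EuclideanSpace ℝ (Fin 3)}
    (hw : IsSmoothSpaceTimeOn (Icc 0 T) w) {C₀ C₁ : ℝ≥0}
    (hC₀ : ∀ t ∈ Icc 0 T, ∫⁻ x, ‖w t x‖ₑ ^ 2 ≤ C₀)
    (hC₁ : ∀ t ∈ Icc 0 T, ∫⁻ x, ‖timeDerivWithin (Icc 0 T) w t x‖ₑ ^ 2 ≤ C₁)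
    {s₀ : ℝ} (hs₀ : s₀ ∈ Icc 0 T) :
    Tendsto (fun s => ∫ x, ‖w s x - w s₀ x‖ ^ 2) (𝓝[Icc 0 T] s₀) (𝓝 0) := by
  have hU : UniqueDiffOn ℝ (Icc 0 T) := uniqueDiffOn_Icc hT
  have hφ : ContDiff ℝ ∞ (w s₀) := hw.contDiff_slice hs₀
  have hconst : IsSmoothSpaceTimeOn (Icc 0 T) (fun (_ : ℝ) x => w s₀ x) :=
    isSmoothSpaceTimeOn_const_time hφ _
  have hd : IsSmoothSpaceTimeOn (Icc 0 T) (fun s x => w s x - w s₀ x) := hw.sub hconst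
  -- slice bounds for the difference and its time derivative
  have hslice : ∀ t ∈ Icc 0 T, Continuous (w t) := fun t ht => (hw.contDiff_slice ht).continuous
  have hD₀ : ∀ t ∈ Icc 0 T, ∫⁻ x, ‖w t x - w s₀ x‖ₑ ^ 2 ≤
      (3 * (ENNReal.ofReal (1 ^ 2) * C₀ + ENNReal.ofReal (1 ^ 2) * C₀ +
        ENNReal.ofReal (0 ^ 2) * 0) : ℝ≥0∞) := by
    intro t ht
    refine (lintegral_enorm_sq_le_of_norm_le_three (f := fun x => w t x - w s₀ x)
      (g₃ := fun _ => (0 : EuclideanSpace ℝ (Fin 3))) (hslice t ht) (hslice s₀ hs₀)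
      continuous_const zero_le_one zero_le_one le_rfl fun x => ?_).trans ?_
    · rw [one_mul, one_mul, zero_mul, add_zero]; exact norm_sub_le _ _
    · gcongr
      · exact hC₀ t ht
      · exact hC₀ s₀ hs₀
      · simp
  set K₀ : ℝ≥0∞ := 3 * (ENNReal.ofReal (1 ^ 2) * C₀ + ENNReal.ofReal (1 ^ 2) * C₀ +
    ENNReal.ofReal (0 ^ 2) * 0) with hK₀
  have hK₀top : K₀ < ⊤ := by
    refine ENNReal.mul_lt_top (by norm_num) ?_
    refine ENNReal.add_lt_top.2 ⟨ENNReal.add_lt_top.2 ⟨?_, ?_⟩, ?_⟩ <;>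
      exact ENNReal.mul_lt_top ENNReal.ofReal_lt_top (by simp [ENNReal.coe_lt_top])
  have hD₁ : ∀ t ∈ Icc 0 T,
      ∫⁻ x, ‖timeDerivWithin (Icc 0 T) (fun s x => w s x - w s₀ x) t x‖ₑ ^ 2 ≤ C₁ := by
    intro t ht
    refine le_of_eq_of_le (lintegral_congr fun x => ?_) (hC₁ t ht)
    rw [hw.timeDerivWithin_fun_sub hconst hU ht x]
    simp [timeDerivWithin_apply]
  obtain ⟨-, hcont, -⟩ := hd.l2_balance hT (C₀ := K₀.toNNReal) (C₁ := C₁)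
    (fun t ht => by rw [ENNReal.coe_toNNReal hK₀top.ne]; exact hD₀ t ht) hD₁
  have h0 : (∫ x, ‖w s₀ x - w s₀ x‖ ^ 2) = 0 := by simp
  have := (hcont s₀ hs₀).tendsto
  rwa [h0] at this


/-! ## §2 Green's second identity in the `H²` class (no decay assumed) -/

/-- **`∫ ⟪η, Δζ⟫ = ∫ ⟪ζ, Δη⟫` for smooth fields with `η, ∂η, ∂∂η ∈ L²` (and the same for `ζ`)**:
both sides equal `−Σᵢ ∫ ⟪∂ᵢη, ∂ᵢζ⟫` by the tree's `H¹` form of the Laplacian pairing beyond compact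
support (`HasWeakGradient.integral_inner_laplacian_of_memLp`, classical derivative as weak gradient).
[folklore] -/
theorem integral_inner_laplacian_symm {η ζ : EuclideanSpace ℝ (Fin 3) → EuclideanSpace ℝ (Fin 3)}
    (hη : ContDiff ℝ ∞ η) (hζ : ContDiff ℝ ∞ ζ) (hη0 : MemLp η 2 volume)
    (hη1 : ∀ i, MemLp (fun x => fderiv ℝ η x (stdOrthonormalBasis ℝ (EuclideanSpace ℝ (Fin 3)) i))
      2 volume)
    (hη2 : ∀ i, MemLp (fun x => fderiv ℝ (fun y => fderiv ℝ η y
      (stdOrthonormalBasis ℝ (EuclideanSpace ℝ (Fin 3)) i)) x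
      (stdOrthonormalBasis ℝ (EuclideanSpace ℝ (Fin 3)) i)) 2 volume)
    (hζ0 : MemLp ζ 2 volume)
    (hζ1 : ∀ i, MemLp (fun x => fderiv ℝ ζ x (stdOrthonormalBasis ℝ (EuclideanSpace ℝ (Fin 3)) i))
      2 volume)
    (hζ2 : ∀ i, MemLp (fun x => fderiv ℝ (fun y => fderiv ℝ ζ y
      (stdOrthonormalBasis ℝ (EuclideanSpace ℝ (Fin 3)) i)) x
      (stdOrthonormalBasis ℝ (EuclideanSpace ℝ (Fin 3)) i)) 2 volume) :
    ∫ x, ⟪η x, (Δ ζ) x⟫ = ∫ x, ⟪ζ x, (Δ η) x⟫ := by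
  have hη1' : ContDiff ℝ 1 η := hη.of_le (by norm_cast)
  have hζ1' : ContDiff ℝ 1 ζ := hζ.of_le (by norm_cast)
  rw [(hasWeakGradient_fderiv_of_contDiff hη1').integral_inner_laplacian_of_memLp hη0 hη1 hζ hζ1 hζ2,
    (hasWeakGradient_fderiv_of_contDiff hζ1').integral_inner_laplacian_of_memLp hζ0 hζ1 hη hη1 hη2]
  congr 1
  exact Finset.sum_congr rfl fun i _ =>
    integral_congr_ae (Eventually.of_forall fun x => real_inner_comm _ _)

/-- `‖∂_w ∂_{w'} f (x)‖ ≤ ‖D²f(x)‖` for unit vectors `w, w'` (`C²` field). [folklore] -/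
theorem norm_fderiv_fderiv_apply_le {F : Type*} [NormedAddCommGroup F] [NormedSpace ℝ F]
    {f : EuclideanSpace ℝ (Fin 3) → F} (hf : ContDiff ℝ 2 f) (x w w' : EuclideanSpace ℝ (Fin 3))
    (hw : ‖w‖ = 1) (hw' : ‖w'‖ = 1) :
    ‖fderiv ℝ (fun y => fderiv ℝ f y w) x w'‖ ≤ ‖iteratedFDeriv ℝ 2 f x‖ := by
  have hd : DifferentiableAt ℝ (fderiv ℝ f) x :=
    (hf.fderiv_right (m := 1) le_rfl).differentiable one_ne_zero x
  rw [fderiv_clm_apply hd (differentiableAt_const w), fderiv_fun_const]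
  simp only [Pi.zero_apply, ContinuousLinearMap.comp_zero, zero_add, ContinuousLinearMap.flip_apply]
  rw [← norm_iteratedFDeriv_fderiv, norm_iteratedFDeriv_one]
  calc ‖fderiv ℝ (fderiv ℝ f) x w' w‖ ≤ ‖fderiv ℝ (fderiv ℝ f) x w'‖ * ‖w‖ :=
        ContinuousLinearMap.le_opNorm _ _
    _ ≤ ‖fderiv ℝ (fderiv ℝ f) x‖ * ‖w'‖ * ‖w‖ := by
        gcongr; exact ContinuousLinearMap.le_opNorm _ _
    _ = ‖fderiv ℝ (fderiv ℝ f) x‖ := by rw [hw, hw', mul_one, mul_one]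

/-- In the class, `ω = curl v`, its first partials and its pure second partials along the standard
frame are in `L²` (from `Dv, D²v, D³v ∈ L²`, `‖Dⁿ curl v‖ ≤ κ ‖Dⁿ⁺¹ v‖`). [folklore] -/
theorem memLp_curl_partials {v : EuclideanSpace ℝ (Fin 3) → EuclideanSpace ℝ (Fin 3)}
    (hv : ContDiff ℝ ∞ v) (h1 : ∫⁻ x, ‖iteratedFDeriv ℝ 1 v x‖ₑ ^ 2 < ⊤)
    (h2 : ∫⁻ x, ‖iteratedFDeriv ℝ 2 v x‖ₑ ^ 2 < ⊤) (h3 : ∫⁻ x, ‖iteratedFDeriv ℝ 3 v x‖ₑ ^ 2 < ⊤) :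
    MemLp (curl v) 2 volume ∧
      (∀ i, MemLp (fun x => fderiv ℝ (curl v) x
        (stdOrthonormalBasis ℝ (EuclideanSpace ℝ (Fin 3)) i)) 2 volume) ∧
      (∀ i, MemLp (fun x => fderiv ℝ (fun y => fderiv ℝ (curl v) y
        (stdOrthonormalBasis ℝ (EuclideanSpace ℝ (Fin 3)) i)) x
        (stdOrthonormalBasis ℝ (EuclideanSpace ℝ (Fin 3)) i)) 2 volume) := by
  set b := stdOrthonormalBasis ℝ (EuclideanSpace ℝ (Fin 3)) with hb
  have hb1 : ∀ i, ‖b i‖ = 1 := fun i => b.orthonormal.1 i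
  set κ : ℝ := ‖curlCLM‖ with hκ
  have hw : ContDiff ℝ ∞ (curl v) := contDiff_curl (n := (⊤ : ℕ∞)) (by exact_mod_cast hv)
  have hw2 : ContDiff ℝ 2 (curl v) := hw.of_le (by norm_cast)
  have hw1 : ContDiff ℝ 1 (curl v) := hw.of_le (by norm_cast)
  -- the dominating `L²` functions `κ ‖Dⁿ v‖`
  have hdom : ∀ n : ℕ, ∫⁻ x, ‖iteratedFDeriv ℝ n v x‖ₑ ^ 2 < ⊤ →
      MemLp (fun x => κ * ‖iteratedFDeriv ℝ n v x‖) 2 volume := by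
    intro n hn
    have hc : Continuous (iteratedFDeriv ℝ n v) := hv.continuous_iteratedFDeriv (by exact_mod_cast le_top)
    exact ((memLp_two_of_continuous hc hn).norm).const_mul κ
  have hκdom : ∀ (n : ℕ) (x : EuclideanSpace ℝ (Fin 3)),
      ‖iteratedFDeriv ℝ n (curl v) x‖ ≤ ‖κ * ‖iteratedFDeriv ℝ (n + 1) v x‖‖ := by
    intro n x
    rw [Real.norm_of_nonneg (by positivity)]
    exact norm_iteratedFDeriv_curl_le_opNorm_mul (N := ⊤) hv n le_top x
  refine ⟨?_, fun i => ?_, fun i => ?_⟩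
  · refine (hdom 1 h1).of_le hw.continuous.aestronglyMeasurable (Eventually.of_forall fun x => ?_)
    have h := hκdom 0 x
    rwa [norm_iteratedFDeriv_zero] at h
  · have hc : Continuous fun x => fderiv ℝ (curl v) x (b i) :=
      (hw1.continuous_fderiv one_ne_zero).clm_apply continuous_const
    refine (hdom 2 h2).of_le hc.aestronglyMeasurable (Eventually.of_forall fun x => ?_)
    refine le_trans ?_ (hκdom 1 x)
    rw [norm_iteratedFDeriv_one]
    calc ‖fderiv ℝ (curl v) x (b i)‖ ≤ ‖fderiv ℝ (curl v) x‖ * ‖b i‖ := ContinuousLinearMap.le_opNorm _ _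
      _ = ‖fderiv ℝ (curl v) x‖ := by rw [hb1, mul_one]
  · have hc : Continuous fun x => fderiv ℝ (fun y => fderiv ℝ (curl v) y (b i)) x (b i) := by
      have hd1 : ContDiff ℝ 1 (fun y => fderiv ℝ (curl v) y (b i)) :=
        (hw2.fderiv_right (m := 1) le_rfl).clm_apply contDiff_const
      exact (hd1.continuous_fderiv one_ne_zero).clm_apply continuous_const
    refine (hdom 3 h3).of_le hc.aestronglyMeasurable (Eventually.of_forall fun x => ?_)
    exact (norm_fderiv_fderiv_apply_le hw2 x (b i) (b i) (hb1 i) (hb1 i)).trans (hκdom 2 x)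

end Summit.NavierStokesRegularity.NavierStokesRegularity.Theorems.Lindgren2012Salvage

end
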